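import Summits.BirchSwinnertonDyer.BirchSwinnertonDyer.Theses.ByReductionTypeAtTwo
import Summits.BirchSwinnertonDyer.Rank1Residual.F1Sign2.FirstLayerLawAtTwoGlue
import HarnessLib

/-!
# Line `fkl` of crux `RankOneAtTwoBigImageOddLocal` (stmt-BirchSwinnertonDyer-23715, route ByReductionTypeAtTwo):
# the line is LOSSLESS modulo its hardest stub — necessity certificates for the open stubs (3) and (5b)

Lead prover seat `bsd-line-fkl-p1` (g0), helpers `--supports stmt-BirchSwinnertonDyer-23715`.  Skeleton v2/v3
(`Cruxes/RankOneAtTwoBigImageOddLocal/Lines/fkl.lean`) proves the crux from K2-F (`stub_katoFirstLayerLaw`), K2-F_an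
(`stub_analyticKatoFirstLayerLaw`), the period transfer, `Ш_an ∈ ℚ^×` and the `2`-integrality of `Ш_an`
(`stub_shaAnTwoIntegralOnSlice`).  This file proves the CONVERSES, curve by curve, with no named fact:

* `shaAnTwoIntegral_of_bsdp`: `BSDp W 2 ⟹ ord₂ Ш_an(W) ≥ 0` (for the rational value of `Ш_an`) — so stub (5b) is implied
  by the crux: `stub_shaAnTwoIntegralOnSlice_of_crux` (literally the registered v3 signature from the route decl).
* `analyticLawAt_of_bsdp_of_lawAt`: for a slice curve with `BSDp W 2`, the K2-F law for `(W, f)` with the ALGEBRAIC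
  parameter `s = ord₂ #Ш[2^∞]` is the K2-F_an law with the ANALYTIC parameter `s_an = ord₂ Ш_an` (they are the same number);
  globally: `analyticFirstLayerLawAtTwo_of_firstLayerLaw_of_bsdp` — K2-F ∧ (BSD₂ on the CM-free slice) ⟹ K2-F_an.
* `bsdp_two_iff_lawsAt`: on the slice, given rank = analytic rank, the newform with its period transfer and the K2-F
  law at `(W, f)`:  `BSDp W 2 ⟺ (K2-F_an law at (W, f, q) ∧ 0 ≤ ord₂ q)` for the rational value `q ≠ 0` of `Ш_an` —
  the per-curve form of the tree glue `F1Sign2.sha_two_val_eq_of_firstLayerLaws` (p561832) and its converse.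
Upshot for the census: modulo PRINT (GZK, modularity, Manin at semistable 2, `Ш_an ∈ ℚ^×`) and the hardest stub K2-F,
the crux on each slice curve is EQUIVALENT to «K2-F_an at its newform ∧ `Ш_an` is a `2`-adic integer» — stubs (3) and
(5b) lose nothing.  Theorems only; no `def`, no named fact, no `sorry`.  BSD is not proved by any of this.
-/

set_option autoImplicit false

noncomputable section

open scoped Classical MatrixGroups ModularForm

set_option linter.dupNamespace false

namespace Summit.BirchSwinnertonDyer.BirchSwinnertonDyer.Theorems.RankOneAtTwoFkl

open CongruenceSubgroup WeierstrassCurve Literature.NumberTheory.EllipticCurves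
  Literature.NumberTheory.EllipticCurves.ModularForms Summit.BirchSwinnertonDyer.Rank1Residual.F1Sign2

/-! ## (5b) is necessary: `BSDp W 2` makes `Ш_an` a `2`-adic integer -/

/-- **`BSD(E,2) ⟹ ord₂ #Ш_an ≥ 0`.**  Miller's `BSDp W 2` supplies `q₀ ∈ ℚ` with `Ш_an = q₀` and
`ord₂ q₀ = ord₂ #Ш[2^∞] ∈ ℕ`; any rational value `q` of `Ш_an` equals `q₀` (`ℚ → ℂ` is injective).
[cite: Miller2011LMS, Def. 1.1 (arXiv:1010.2431 p. 3)] -/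
theorem shaAnTwoIntegral_of_bsdp (W : WeierstrassCurve ℚ) (h : BSDp W 2) (q : ℚ) (hq : shaAn W = (q : ℂ)) :
    0 ≤ padicValRat 2 q := by
  obtain ⟨-, -, q₀, hq₀, hv⟩ := h
  have hqq : q = q₀ := by exact_mod_cast hq.symm.trans hq₀
  rw [hqq, hv]
  exact_mod_cast Nat.zero_le _

/-- **Stub (5b) of line fkl is implied by the crux** (registered v3 signature, verbatim): on the slice in analytic rank one,
`Ш_an`, when rational, is a `2`-adic integer — GIVEN `RankOneAtTwoBigImageOddLocal`.  So (5b) is no stronger than the crux.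
[cite: Miller2011LMS, Def. 1.1 (arXiv:1010.2431 p. 3)] -/
theorem stub_shaAnTwoIntegralOnSlice_of_crux
    (hX : Summit.BirchSwinnertonDyer.BirchSwinnertonDyer.Theses.ByReductionTypeAtTwo.RankOneAtTwoBigImageOddLocal) :
    ∀ (W : WeierstrassCurve ℚ) [W.IsElliptic] [W.IsGloballyMinimal], ¬ W.HasCM →
      (∀ n : ℕ, W.HasSurjectiveModNGaloisRep ((2 ^ n : ℕ) : ℤ)) → Odd W.torsionOrder → Odd W.tamagawaProduct →
      W.analyticRank = 1 → ∀ q : ℚ, shaAn W = (q : ℂ) → 0 ≤ padicValRat 2 q := by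
  intro W _ _ hcm hsurj hT hc han q hq
  exact shaAnTwoIntegral_of_bsdp W (hX W hcm hsurj hT hc han) q hq

/-! ## (3) is necessary given (2): under `BSDp W 2` the algebraic law IS the analytic law -/

/-- Under `BSDp W 2` the analytic parameter equals the algebraic one: for the rational value `q` of `Ш_an`,
`(ord₂ q).toNat = ord₂ #Ш(E)[2^∞]`. [cite: Miller2011LMS, Def. 1.1 (arXiv:1010.2431 p. 3)] -/
theorem toNat_padicValRat_shaAn_eq_of_bsdp (W : WeierstrassCurve ℚ) (h : BSDp W 2) (q : ℚ)
    (hq : shaAn W = (q : ℂ)) :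
    (padicValRat 2 q).toNat = padicValNat 2 (Nat.card (AddCommGroup.primaryComponent W.sha 2)) := by
  obtain ⟨-, -, q₀, hq₀, hv⟩ := h
  have hqq : q = q₀ := by exact_mod_cast hq.symm.trans hq₀
  rw [hqq, hv, Int.toNat_natCast]

/-- **K2-F at `(W, f)` ∧ `BSDp W 2` ⟹ K2-F_an at `(W, f)`** (per curve, no named fact).  The K2-F law (a)+(b) for the
first Kolyvagin layer of `(W, f)` with parameter `s = ord₂ #Ш[2^∞]`, and `BSD(E,2)`, give the same law with the analytic
parameter `s_an = (ord₂ q).toNat` for every rational value `q` of `Ш_an` — because `s_an = s`.  Hypotheses of K2-F that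
`BSDp` supplies: `rank = 1` (from `r_an = 1`) and `Ш[2^∞]` finite. [conjecture] input K2-F, kernel glue. -/
theorem analyticLawAt_of_bsdp_of_firstLayerLaw (hF : FirstLayerLawAtTwo)
    (W : WeierstrassCurve ℚ) [W.IsElliptic] [W.IsGloballyMinimal] {M : ℕ} [NeZero M]
    (f : CuspForm (Gamma0 M) 2) (hf : IsNewformOf W f) (hper : PeriodTransferAtTwo W f)
    (hsurj : ∀ n : ℕ, W.HasSurjectiveModNGaloisRep ((2 ^ n : ℕ) : ℤ)) (hT : Odd W.torsionOrder)
    (hc : Odd W.tamagawaProduct) (hw : W.rootNumber = -1) (han : W.analyticRank = 1) (hbsd : BSDp W 2)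
    (q : ℚ) (hq : shaAn W = (q : ℂ)) :
    let s := (padicValRat 2 q).toNat
    (∀ (ℓ k : ℕ) [Fact ℓ.Prime], IsLevelAtTwo W ℓ → 1 ≤ k → (2 ^ k : ℤ) ∣ (ℓ : ℤ) - 1 →
        (2 ^ k : ℤ) ∣ W.frobeniusTrace ℓ - 2 →
        ∀ ψ : (ZMod ℓ)ˣ →* Multiplicative (ZMod (2 ^ k)), Function.Surjective ψ →
          InTwoPowZLoc (min k (s + 1)) (levelSumTwo f ℓ k ψ)) ∧
    (∃ (ℓ k : ℕ) (_ : Fact ℓ.Prime) (ψ : (ZMod ℓ)ˣ →* Multiplicative (ZMod (2 ^ k))),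
        IsLevelAtTwo W ℓ ∧ s + 2 ≤ k ∧ (2 ^ k : ℤ) ∣ (ℓ : ℤ) - 1 ∧ (2 ^ k : ℤ) ∣ W.frobeniusTrace ℓ - 2 ∧
        Function.Surjective ψ ∧ ¬ InTwoPowZLoc (s + 2) (levelSumTwo f ℓ k ψ)) := by
  have hs := toNat_padicValRat_shaAn_eq_of_bsdp W hbsd q hq
  obtain ⟨hrk, hfin, -⟩ := hbsd
  have hr : W.mordellWeilRank = 1 := by rw [hrk, han]
  have HF := hF W f hf hper hsurj hT hc hw hr hfin
  simp only at HF ⊢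
  rw [hs]
  exact HF

/-- **K2-F ∧ BSD₂ on the CM-free slice ⟹ K2-F_an** (global form): if the first-layer law holds and `BSD(E,2)` holds for
every globally minimal `E/ℚ` of analytic rank one with `ρ_{E,2^∞}` onto, odd torsion and odd Tamagawa product (the crux
WITHOUT its `¬CM` binder — vacuously different: CM curves never have `ρ_{E,4}` onto, a fact not used here), then the
analytic first-layer law `F1Sign2.AnalyticFirstLayerLawAtTwo` holds. [conjecture] inputs, kernel glue. -/
theorem analyticFirstLayerLawAtTwo_of_firstLayerLaw_of_bsdp (hF : FirstLayerLawAtTwo)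
    (hX : ∀ (W : WeierstrassCurve ℚ) [W.IsElliptic] [W.IsGloballyMinimal],
      (∀ n : ℕ, W.HasSurjectiveModNGaloisRep ((2 ^ n : ℕ) : ℤ)) → Odd W.torsionOrder → Odd W.tamagawaProduct →
      W.analyticRank = 1 → BSDp W 2) :
    AnalyticFirstLayerLawAtTwo := by
  intro W _ _ M _ f hf hper hsurj hT hc hw han q hq _hq0
  exact analyticLawAt_of_bsdp_of_firstLayerLaw hF W f hf hper hsurj hT hc hw han (hX W hsurj hT hc han) q hq

/-! ## The per-curve equivalence: modulo K2-F (and rank = analytic rank) the crux at `W` IS «K2-F_an at `W` ∧ (5b) at `W`» -/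

/-- **Per-curve squeeze** (the tree's `sha_two_val_eq_of_firstLayerLaws`, p561832, with the two laws supplied AT `(W, f)`
only): a K2-F-shaped law with parameter `s` and a K2-F_an-shaped law with parameter `s'` over the same first layer force
`s = s'` (minimum-exponent argument `F1Sign2.param_eq_of_two_laws`). [folklore] -/
theorem param_eq_of_lawsAt (W : WeierstrassCurve ℚ) [W.IsElliptic] [W.IsGloballyMinimal] {M : ℕ}
    (f : CuspForm (Gamma0 M) 2) (s s' : ℕ)
    (hA : (∀ (ℓ k : ℕ) [Fact ℓ.Prime], IsLevelAtTwo W ℓ → 1 ≤ k → (2 ^ k : ℤ) ∣ (ℓ : ℤ) - 1 →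
        (2 ^ k : ℤ) ∣ W.frobeniusTrace ℓ - 2 →
        ∀ ψ : (ZMod ℓ)ˣ →* Multiplicative (ZMod (2 ^ k)), Function.Surjective ψ →
          InTwoPowZLoc (min k (s + 1)) (levelSumTwo f ℓ k ψ)) ∧
      (∃ (ℓ k : ℕ) (_ : Fact ℓ.Prime) (ψ : (ZMod ℓ)ˣ →* Multiplicative (ZMod (2 ^ k))),
        IsLevelAtTwo W ℓ ∧ s + 2 ≤ k ∧ (2 ^ k : ℤ) ∣ (ℓ : ℤ) - 1 ∧ (2 ^ k : ℤ) ∣ W.frobeniusTrace ℓ - 2 ∧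
        Function.Surjective ψ ∧ ¬ InTwoPowZLoc (s + 2) (levelSumTwo f ℓ k ψ)))
    (hB : (∀ (ℓ k : ℕ) [Fact ℓ.Prime], IsLevelAtTwo W ℓ → 1 ≤ k → (2 ^ k : ℤ) ∣ (ℓ : ℤ) - 1 →
        (2 ^ k : ℤ) ∣ W.frobeniusTrace ℓ - 2 →
        ∀ ψ : (ZMod ℓ)ˣ →* Multiplicative (ZMod (2 ^ k)), Function.Surjective ψ →
          InTwoPowZLoc (min k (s' + 1)) (levelSumTwo f ℓ k ψ)) ∧
      (∃ (ℓ k : ℕ) (_ : Fact ℓ.Prime) (ψ : (ZMod ℓ)ˣ →* Multiplicative (ZMod (2 ^ k))),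
        IsLevelAtTwo W ℓ ∧ s' + 2 ≤ k ∧ (2 ^ k : ℤ) ∣ (ℓ : ℤ) - 1 ∧ (2 ^ k : ℤ) ∣ W.frobeniusTrace ℓ - 2 ∧
        Function.Surjective ψ ∧ ¬ InTwoPowZLoc (s' + 2) (levelSumTwo f ℓ k ψ))) : s = s' := by
  obtain ⟨ha, ℓ, k, hℓ, ψ, hlev, hk, hd1, hd2, hψ, hnot⟩ := hA
  obtain ⟨ha', ℓ', k', hℓ', ψ', hlev', hk', hd1', hd2', hψ', hnot'⟩ := hB
  let ι := (l : ℕ) × (j : ℕ) × (PLift (Fact l.Prime) × ((ZMod l)ˣ →* Multiplicative (ZMod (2 ^ j))))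
  let adm : ι → Prop := fun i =>
    haveI : Fact i.1.Prime := i.2.2.1.down
    IsLevelAtTwo W i.1 ∧ 1 ≤ i.2.1 ∧ (2 ^ i.2.1 : ℤ) ∣ (i.1 : ℤ) - 1 ∧
      (2 ^ i.2.1 : ℤ) ∣ W.frobeniusTrace i.1 - 2 ∧ Function.Surjective i.2.2.2
  let x : ι → ℚ := fun i =>
    haveI : Fact i.1.Prime := i.2.2.1.down
    levelSumTwo f i.1 i.2.1 i.2.2.2
  refine param_eq_of_two_laws adm (fun i => i.2.1) x _ _ ?_
    ⟨⟨ℓ, k, ⟨hℓ⟩, ψ⟩, ⟨hlev, (show 1 ≤ k by omega), hd1, hd2, hψ⟩, hk, hnot⟩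
    ?_ ⟨⟨ℓ', k', ⟨hℓ'⟩, ψ'⟩, ⟨hlev', (show 1 ≤ k' by omega), hd1', hd2', hψ'⟩, hk', hnot'⟩
  · rintro ⟨l, j, ⟨hl⟩, φ⟩ ⟨h1, h2, h3, h4, h5⟩
    exact @ha l j hl h1 h2 h3 h4 φ h5
  · rintro ⟨l, j, ⟨hl⟩, φ⟩ ⟨h1, h2, h3, h4, h5⟩
    exact @ha' l j hl h1 h2 h3 h4 φ h5

/-- **The per-curve equivalence.**  Given `rank = r_an` and `Ш[2^∞]` finite for `W` (GZK at `W`), a cusp form `f`, the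
K2-F-shaped law at `(W, f)` with the algebraic parameter `s = ord₂ #Ш[2^∞]` (hypothesis `hFW`: what the hardest stub gives AT
THIS CURVE on the slice), and a rational value `q` of `Ш_an`:
`BSDp W 2 ⟺ (the K2-F_an law at (W, f, q)) ∧ 0 ≤ ord₂ q`.  (⟸ is the tree squeeze; ⟹ is
`analyticLawAt_of_bsdp_of_firstLayerLaw` + `shaAnTwoIntegral_of_bsdp`.)  Hence the fkl skeleton is LOSSLESS on each curve
modulo its hardest stub and PRINT. [conjecture] input K2-F at `W`, kernel glue. -/
theorem bsdp_two_iff_lawsAt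
    (W : WeierstrassCurve ℚ) [W.IsElliptic] [W.IsGloballyMinimal] {M : ℕ} [NeZero M]
    (f : CuspForm (Gamma0 M) 2)
    (hrk : W.mordellWeilRank = W.analyticRank) (hfin : Finite (AddCommGroup.primaryComponent W.sha 2))
    (hFW : let s := padicValNat 2 (Nat.card (AddCommGroup.primaryComponent W.sha 2))
      (∀ (ℓ k : ℕ) [Fact ℓ.Prime], IsLevelAtTwo W ℓ → 1 ≤ k → (2 ^ k : ℤ) ∣ (ℓ : ℤ) - 1 →
        (2 ^ k : ℤ) ∣ W.frobeniusTrace ℓ - 2 →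
        ∀ ψ : (ZMod ℓ)ˣ →* Multiplicative (ZMod (2 ^ k)), Function.Surjective ψ →
          InTwoPowZLoc (min k (s + 1)) (levelSumTwo f ℓ k ψ)) ∧
      (∃ (ℓ k : ℕ) (_ : Fact ℓ.Prime) (ψ : (ZMod ℓ)ˣ →* Multiplicative (ZMod (2 ^ k))),
        IsLevelAtTwo W ℓ ∧ s + 2 ≤ k ∧ (2 ^ k : ℤ) ∣ (ℓ : ℤ) - 1 ∧ (2 ^ k : ℤ) ∣ W.frobeniusTrace ℓ - 2 ∧
        Function.Surjective ψ ∧ ¬ InTwoPowZLoc (s + 2) (levelSumTwo f ℓ k ψ)))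
    (q : ℚ) (hq : shaAn W = (q : ℂ)) :
    BSDp W 2 ↔
      ((let s := (padicValRat 2 q).toNat
        (∀ (ℓ k : ℕ) [Fact ℓ.Prime], IsLevelAtTwo W ℓ → 1 ≤ k → (2 ^ k : ℤ) ∣ (ℓ : ℤ) - 1 →
          (2 ^ k : ℤ) ∣ W.frobeniusTrace ℓ - 2 →
          ∀ ψ : (ZMod ℓ)ˣ →* Multiplicative (ZMod (2 ^ k)), Function.Surjective ψ →
            InTwoPowZLoc (min k (s + 1)) (levelSumTwo f ℓ k ψ)) ∧
        (∃ (ℓ k : ℕ) (_ : Fact ℓ.Prime) (ψ : (ZMod ℓ)ˣ →* Multiplicative (ZMod (2 ^ k))),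
          IsLevelAtTwo W ℓ ∧ s + 2 ≤ k ∧ (2 ^ k : ℤ) ∣ (ℓ : ℤ) - 1 ∧ (2 ^ k : ℤ) ∣ W.frobeniusTrace ℓ - 2 ∧
          Function.Surjective ψ ∧ ¬ InTwoPowZLoc (s + 2) (levelSumTwo f ℓ k ψ))) ∧
      0 ≤ padicValRat 2 q) := by
  constructor
  · intro hbsd
    refine ⟨?_, shaAnTwoIntegral_of_bsdp W hbsd q hq⟩
    have hs := toNat_padicValRat_shaAn_eq_of_bsdp W hbsd q hq
    simp only at hFW ⊢
    rw [hs]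
    exact hFW
  · rintro ⟨hAW, hint⟩
    have hs : padicValNat 2 (Nat.card (AddCommGroup.primaryComponent W.sha 2)) = (padicValRat 2 q).toNat :=
      param_eq_of_lawsAt W f _ _ hFW hAW
    refine ⟨hrk, hfin, q, hq, ?_⟩
    rw [hs, Int.toNat_of_nonneg hint]

end Summit.BirchSwinnertonDyer.BirchSwinnertonDyer.Theorems.RankOneAtTwoFkl

end
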